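/-
Copyright (c) 2026. All rights reserved.
Released under Apache 2.0 license as described in the file LICENSE.
-/
import Literature.NumberTheory.PAdicHodge.SenFiniteVectorsSubgroup
import Mathlib.RingTheory.Trace.Basic
import Mathlib.FieldTheory.Galois.Basic
import HarnessLib

/-!
# Sen's finite vectors: Galois descent from `\widehat{N K_∞}` to `\widehat{K_∞}`

The third file of the Sen-decompletion sequence (`SenFiniteVectorsBase`, `SenFiniteVectorsSubgroup`).
Sen's theory over a `p`-adic field runs over the cyclotomic tower of that field, not of `K₀ = ℚ_p`;
the passage is a finite Galois descent.  Let `N ⊆ F̄` be a finite Galois extension of `K₀` and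
`H_N = H ∩ Gal(F̄/N)` (`H = Gal(F̄/K_∞)`), an open subgroup of `H` with `ℂ_F^{H_N} = \widehat{N K_∞}`
(Ax–Sen–Tate).  We prove the explicit descent formula

  `x = ∑_i b_i · c_i`,  `c_i = ∑_{σ ∈ H|_N} σ(b^∨_i) · (g_σ • x) ∈ X = \widehat{K_∞}`

for every `x ∈ ℂ_F` fixed by `H_N`, where `b` is a `K₀`-basis of `N`, `b^∨` its trace-dual basis,
`H|_N ≤ Gal(N/K₀)` the image of `H` and `g_σ ∈ H` any lift of `σ` — from the **Galois dual-basis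
identity** `∑_i σ(b^∨_i) b_i = [σ = 1]` (`sum_aut_traceDual_mul_eq`: the matrices `(τ b_i)` and
`(τ b^∨_i)` are mutually inverse because `Tr = ∑_τ τ`).  Consequently (`SenFiniteVectorsSubgroup`)
an `H_N`-fixed element of `ℂ_F` whose `Gal(F̄/N)`-orbit spans a finite-dimensional `K₀`-space lies
in `F̄` (indeed in `N K_∞`): the coordinates `c_i` are `Gal(F̄/N)`-finite elements of `\widehat{K_∞}`,
hence lie in `K_∞`.  This is the scalar case (`W = ℂ_F`) of Sen's theorem
`(W^{H_L})^{Γ_L-fin} = D_Sen(W)` over a `p`-adic field `L` (Brinon–Conrad Thm. 15.1.5), for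
`L = N`, reduced to the base tower.

* `sum_aut_traceDual_mul_eq` — the Galois dual-basis identity (any finite Galois extension).
* `TateTrace.exists_sum_coe_mul_eq_of_forall_smul_eq` — ★ the descent formula: `x = ∑ b_i c_i` with
  `c_i ∈ X` of the explicit shape above.
* `TateTrace.exists_coe_eq_of_forall_smul_eq_of_orbit_subset_span` — ★ `H_N`-fixed and
  `Gal(F̄/N)`-finite elements of `ℂ_F` lie in `N K_∞ ⊆ F̄`.
* `TateTrace.exists_coe_eq_of_forall_absoluteGaloisGroup_smul_eq_of_orbit_subset_span` — ★ the
  `Γ_F`-form: an element of `ℂ_F` fixed by `H_F = ker(χ_F|Γ_F → ℤ_pˣ) ∩ …` (the `σ ∈ Γ_F` fixing all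
  `ζ_{p^M}`) with `Γ_F`-orbit in a finite `K₀`-span lies in `F̄` — `(\widehat{F_∞})^{Γ_F-fin} ⊆ F̄`,
  the scalar case of Sen's theorem over `F`.

References: O. Brinon, B. Conrad, *CMI Summer School notes on p-adic Hodge theory* (2009),
Thm. 15.1.2 and Thm. 15.1.5 [BrinonConrad2009]; J. Tate, *p-divisible groups* (1967), §3.1–§3.3
[Tate1967]; F. DeMeyer, E. Ingraham, *Separable algebras over commutative rings*, LNM 181
(1971), Ch. III Prop. 1.2 [DeMeyerIngraham1971] (the Galois condition `Σⱼ xⱼ σ(yⱼ) = δ_{σ,1}`);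
S. Sen, *Continuous cohomology and p-adic Galois representations*, Invent. Math. 62 (1980) [Sen1980]
(original source, not consulted).
-/

noncomputable section

open ValuativeRel Field UniformSpace Finset Module

namespace Literature.NumberTheory.PAdicHodge

/-! ### The Galois dual-basis identity -/

section GaloisDualBasis

variable {K L : Type*} [Field K] [Field L] [Algebra K L] [FiniteDimensional K L] [IsGalois K L]
  {ι : Type*} [Fintype ι] [DecidableEq ι]

/-- **Galois dual-basis identity.**  For a `K`-basis `b` of a finite Galois extension `L/K` with
trace-dual basis `b^∨` (`Tr(b_i b^∨_j) = δ_{ij}`) and `σ ∈ Gal(L/K)`: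
`∑ i, σ(b^∨_i) · b_i = 1` if `σ = 1` and `= 0` otherwise.  Proof: with `A_{iτ} = τ(b_i)`,
`B_{τ i} = τ(b^∨_i)`, `(A B)_{ij} = ∑_τ τ(b_i b^∨_j) = Tr(b_i b^∨_j) = δ_{ij}` (`Tr = ∑_τ τ` for a Galois
extension), and `#Gal(L/K) = [L : K]`, so `B A = 1` as well; its `(σ, 1)` entry is the claim.
(The identity behind Galois descent along `L/K`: the Chase–Harrison–Rosenberg Galois condition
`∃ xⱼ yⱼ, Σⱼ xⱼ σ(yⱼ) = δ_{σ,1}`, here with the explicit witnesses `xⱼ = bⱼ`, `yⱼ = bⱼ^∨`.)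
[cite: DeMeyerIngraham1971, Ch. III Prop. 1.2 (2)(ii)] -/
theorem sum_aut_traceDual_mul_eq [DecidableEq (L ≃ₐ[K] L)] (b : Basis ι K L) (σ : L ≃ₐ[K] L) :
    ∑ i, σ (b.traceDual i) * b i = if σ = 1 then 1 else 0 := by
  classical
  let A : Matrix ι (L ≃ₐ[K] L) L := fun i τ => τ (b i)
  let B : Matrix (L ≃ₐ[K] L) ι L := fun τ i => τ (b.traceDual i)
  have hAB : A * B = 1 := by
    ext i j
    rw [Matrix.mul_apply, Matrix.one_apply]
    have h1 : ∑ τ : L ≃ₐ[K] L, A i τ * B τ j =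
        algebraMap K L (Algebra.trace K L (b i * b.traceDual j)) := by
      rw [trace_eq_sum_automorphisms]
      exact Finset.sum_congr rfl fun τ _ => (map_mul τ _ _).symm
    rw [h1, b.trace_mul_traceDual]
    split_ifs <;> simp
  have hcard : Fintype.card (L ≃ₐ[K] L) = Fintype.card ι := by
    rw [← Nat.card_eq_fintype_card, IsGalois.card_aut_eq_finrank, Module.finrank_eq_card_basis b]
  have hBA : B * A = 1 := (Matrix.mul_eq_one_comm_of_card_eq ι (L ≃ₐ[K] L) L hcard.symm).mp hAB
  have h := congrFun (congrFun hBA σ) 1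
  rw [Matrix.mul_apply, Matrix.one_apply] at h
  simpa [A, B] using h

/-- The dual-basis identity with the factors commuted: `∑ i, b_i · σ(b^∨_i) = [σ = 1]`.
[cite: DeMeyerIngraham1971, Ch. III Prop. 1.2 (2)(ii)] -/
theorem sum_mul_aut_traceDual_eq [DecidableEq (L ≃ₐ[K] L)] (b : Basis ι K L) (σ : L ≃ₐ[K] L) :
    ∑ i, b i * σ (b.traceDual i) = if σ = 1 then 1 else 0 := by
  rw [← sum_aut_traceDual_mul_eq b σ]
  exact Finset.sum_congr rfl fun i _ => mul_comm _ _

end GaloisDualBasis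

/-! ### Descent from `ℂ_F^{H_N}` to `X = \widehat{K_∞}` -/

open Literature.NumberTheory.GaloisRepresentations
open Literature.NumberTheory.GaloisRepresentations.IsNonarchimedeanLocalField
open CyclotomicTower

variable {F : Type} [Field F] [ValuativeRel F] [TopologicalSpace F] [IsNonarchimedeanLocalField F]
  [CharZero F] {p : ℕ} [Fact p.Prime] (hp : valuation F p < 1)

namespace TateTrace

variable (N : IntermediateField (PadicBase F p hp) (NormedAlgClosure F))
  [FiniteDimensional (PadicBase F p hp) N] [IsGalois (PadicBase F p hp) N]

omit [FiniteDimensional (PadicBase F p hp) N] in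
/-- The restriction `g ↦ g|_N ∈ Gal(N/K₀)` on coerced elements: `↑((g|_N) y) = g • ↑y`. [folklore] -/
private theorem coe_restrictNormalHom_apply (g : BaseGaloisGroup hp) (y : N) :
    ((AlgEquiv.restrictNormalHom N g y : N) : NormedAlgClosure F) = g • (y : NormedAlgClosure F) :=
  AlgEquiv.restrictNormalHom_apply N g y

omit [FiniteDimensional (PadicBase F p hp) N] in
/-- In `ℂ_F`: `g • ↑↑y = ↑↑((g|_N) y)`. [folklore] -/
private theorem base_smul_coe_coe (g : BaseGaloisGroup hp) (y : N) :
    g • (((y : NormedAlgClosure F)) : CompletedAlgClosure F) =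
      (((AlgEquiv.restrictNormalHom N g y : N) : NormedAlgClosure F) : CompletedAlgClosure F) := by
  rw [CompletedAlgClosure.base_smul_coe, coe_restrictNormalHom_apply]

omit [FiniteDimensional (PadicBase F p hp) N] in
/-- `g|_N = 1` iff `g` fixes `N` pointwise. [folklore] -/
private theorem restrictNormalHom_eq_one_iff (g : BaseGaloisGroup hp) :
    AlgEquiv.restrictNormalHom N g = 1 ↔ ∀ y : N, g • (y : NormedAlgClosure F) = y := by
  rw [show AlgEquiv.restrictNormalHom N g = g.restrictNormal N from rfl,
    AlgEquiv.restrictNormal_eq_one_iff]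
  constructor
  · intro h y; exact h y y.2
  · intro h y hy; exact h ⟨y, hy⟩

omit [FiniteDimensional (PadicBase F p hp) N] [IsGalois (PadicBase F p hp) N] in
/-- The double coercion `N → F̄ → ℂ_F` is a ring homomorphism (used to transport sums). [folklore] -/
private theorem coe_coe_sum {κ : Type} (s : Finset κ) (f : κ → N) :
    (((∑ k ∈ s, f k : N) : NormedAlgClosure F) : CompletedAlgClosure F) =
      ∑ k ∈ s, (((f k : N) : NormedAlgClosure F) : CompletedAlgClosure F) := by
  exact map_sum ((Completion.coeRingHom : NormedAlgClosure F →+* CompletedAlgClosure F).comp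
    (algebraMap N (NormedAlgClosure F))) f s

/-- ★ **Galois descent formula `ℂ_F^{H_N} = N · \widehat{K_∞}`.**  Let `N ⊆ F̄` be finite Galois over
`K₀` with `K₀`-basis `b`, and let `x ∈ ℂ_F` be fixed by every `g ∈ G₀` fixing all `ζ_{p^M}` and
fixing `N` pointwise (i.e. by `H_N = H ∩ Gal(F̄/N)`).  Then `x = ∑_i b_i · c_i` with every
`c_i ∈ X = \widehat{K_∞}`, and explicitly `c_i = ∑_{t ∈ T} a_{i,t} · (t • x)` for a finite set `T ⊆ H`
of automorphisms fixing all `ζ_{p^M}` and coefficients `a_{i,t} ∈ N` (namely `T` = chosen lifts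
`g_σ` of the elements `σ` of the image of `H` in `Gal(N/K₀)`, `a_{i,g_σ} = σ(b^∨_i)`).  Proof:
`∑_i b_i c_i = ∑_σ (∑_i b_i σ(b^∨_i)) g_σ • x = g_1 • x = x` by the dual-basis identity; and for
`h ∈ H` with image `ρ`, `h • c_i = ∑_σ (ρσ)(b^∨_i) · (h g_σ) • x` with `(h g_σ) • x = g_{ρσ} • x`
(`g_{ρσ}⁻¹ h g_σ ∈ H_N`), a re-indexing of the sum, so `c_i ∈ ℂ_F^H = X` (Ax–Sen–Tate,
`fixedPoints_eq_X`). [cite: BrinonConrad2009, Thm. 15.1.2 and Thm. 15.1.5 (case of the trivial representation)]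
[cite: Tate1967, §3.3 Theorem 1] -/
theorem exists_sum_coe_mul_eq_of_forall_smul_eq {ι : Type} [Fintype ι] [DecidableEq ι]
    (b : Basis ι (PadicBase F p hp) N) {x : CompletedAlgClosure F}
    (hx : ∀ g : BaseGaloisGroup hp, (∀ M, g • zeta F p M = zeta F p M) →
      (∀ y : N, g • (y : NormedAlgClosure F) = y) → g • x = x) :
    ∃ (T : Finset (BaseGaloisGroup hp)) (a : ι → BaseGaloisGroup hp → N),
      (∀ t ∈ T, ∀ M, t • zeta F p M = zeta F p M) ∧
      (∀ i, (∑ t ∈ T, (((a i t : N) : NormedAlgClosure F) : CompletedAlgClosure F) * (t • x)) ∈ X hp) ∧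
      x = ∑ i, (((b i : N) : NormedAlgClosure F) : CompletedAlgClosure F) *
        ∑ t ∈ T, (((a i t : N) : NormedAlgClosure F) : CompletedAlgClosure F) * (t • x) := by
  classical
  -- notation
  let G := BaseGaloisGroup hp
  let Q := N ≃ₐ[PadicBase F p hp] N
  let r : G →* Q := AlgEquiv.restrictNormalHom N
  let FixZ : G → Prop := fun g => ∀ M, g • zeta F p M = zeta F p M
  have fixZ_one : FixZ 1 := fun M => one_smul _ _
  have fixZ_mul : ∀ {g h : G}, FixZ g → FixZ h → FixZ (g * h) := fun hg hh M => by
    rw [mul_smul, hh M, hg M]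
  have fixZ_inv : ∀ {g : G}, FixZ g → FixZ g⁻¹ := fun {g} hg M => by
    rw [← hg M, ← mul_smul, inv_mul_cancel, one_smul, hg M]
  -- the image `S` of `H` in `Q` and chosen lifts
  let S : Finset Q := Finset.univ.filter fun σ => ∃ g : G, FixZ g ∧ r g = σ
  have hS : ∀ {σ}, σ ∈ S ↔ ∃ g : G, FixZ g ∧ r g = σ := fun {σ} => by
    simp only [S, Finset.mem_filter, Finset.mem_univ, true_and]
  let lift : Q → G := fun σ => if h : ∃ g : G, FixZ g ∧ r g = σ then h.choose else 1
  have lift_spec : ∀ {σ}, σ ∈ S → FixZ (lift σ) ∧ r (lift σ) = σ := by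
    intro σ hσ
    have h := hS.mp hσ
    simp only [lift, dif_pos h]
    exact h.choose_spec
  have one_mem_S : (1 : Q) ∈ S := hS.mpr ⟨1, fixZ_one, map_one r⟩
  -- `g • x` only depends on `r g` for `g ∈ H`
  have smul_eq_of_r_eq : ∀ {g g' : G}, FixZ g → FixZ g' → r g = r g' → g • x = g' • x := by
    intro g g' hg hg' hr
    have h1 : (g'⁻¹ * g) • x = x := by
      refine hx _ (fixZ_mul (fixZ_inv hg') hg) ((restrictNormalHom_eq_one_iff hp N _).mp ?_)
      rw [map_mul, map_inv, hr, inv_mul_cancel]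
    have := congrArg (fun y => g' • y) h1
    simpa only [← mul_smul, mul_inv_cancel_left] using this
  -- the data
  let T : Finset G := S.image lift
  let a : ι → G → N := fun i t => (r t) (b.traceDual i)
  have lift_injOn : Set.InjOn lift S := by
    intro σ hσ τ hτ h
    rw [← (lift_spec hσ).2, ← (lift_spec hτ).2, h]
  -- rewrite the sums over `T` as sums over `S`
  have sumT : ∀ f : G → CompletedAlgClosure F,
      ∑ t ∈ T, f t = ∑ σ ∈ S, f (lift σ) := fun f => Finset.sum_image lift_injOn
  refine ⟨T, a, ?_, ?_, ?_⟩
  · -- `T ⊆ H`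
    intro t ht M
    obtain ⟨σ, hσ, rfl⟩ := Finset.mem_image.mp ht
    exact (lift_spec hσ).1 M
  · -- `c_i ∈ X`
    intro i
    rw [← fixedPoints_eq_X hp]
    intro h hh
    rw [sumT, Finset.smul_sum]
    simp_rw [smul_mul', base_smul_coe_coe hp N]
    -- `h • lift σ • x = lift (r h * σ) • x`
    have hρ : r h ∈ S := hS.mpr ⟨h, hh, rfl⟩
    have hmulS : ∀ {σ}, σ ∈ S → r h * σ ∈ S := by
      intro σ hσ
      obtain ⟨g, hg, rfl⟩ := hS.mp hσ
      exact hS.mpr ⟨h * g, fixZ_mul hh hg, map_mul r h g⟩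
    have key : ∀ σ ∈ S, (((r h (a i (lift σ)) : N) : NormedAlgClosure F) : CompletedAlgClosure F) *
        h • lift σ • x =
        (((a i (lift (r h * σ)) : N) : NormedAlgClosure F) : CompletedAlgClosure F) *
          lift (r h * σ) • x := by
      intro σ hσ
      have e1 : r h (a i (lift σ)) = a i (lift (r h * σ)) := by
        show r h ((r (lift σ)) (b.traceDual i)) = (r (lift (r h * σ))) (b.traceDual i)
        rw [(lift_spec hσ).2, (lift_spec (hmulS hσ)).2, AlgEquiv.mul_apply]
      have e2 : h • lift σ • x = lift (r h * σ) • x := by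
        rw [← mul_smul]
        exact smul_eq_of_r_eq (fixZ_mul hh (lift_spec hσ).1) (lift_spec (hmulS hσ)).1
          (by rw [map_mul, (lift_spec hσ).2, (lift_spec (hmulS hσ)).2])
      rw [e1, e2]
    rw [Finset.sum_congr rfl key]
    -- re-index `σ ↦ r h * σ`
    have hinvS : ∀ {σ}, σ ∈ S → (r h)⁻¹ * σ ∈ S := by
      intro σ hσ
      obtain ⟨g, hg, rfl⟩ := hS.mp hσ
      exact hS.mpr ⟨h⁻¹ * g, fixZ_mul (fixZ_inv hh) hg, by rw [map_mul, map_inv]⟩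
    exact Finset.sum_nbij' (fun σ => r h * σ) (fun σ => (r h)⁻¹ * σ) (fun σ hσ => hmulS hσ)
      (fun σ hσ => hinvS hσ) (fun σ _ => inv_mul_cancel_left _ _) (fun σ _ => mul_inv_cancel_left _ _)
      (fun σ _ => rfl)
  · -- the formula `x = ∑ b_i c_i`
    symm
    calc ∑ i, (((b i : N) : NormedAlgClosure F) : CompletedAlgClosure F) *
          ∑ t ∈ T, (((a i t : N) : NormedAlgClosure F) : CompletedAlgClosure F) * (t • x)
        = ∑ σ ∈ S, (∑ i, (((b i : N) : NormedAlgClosure F) : CompletedAlgClosure F) *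
            (((σ (b.traceDual i) : N) : NormedAlgClosure F) : CompletedAlgClosure F)) * (lift σ • x) := by
          simp_rw [sumT, Finset.mul_sum, ← mul_assoc]
          rw [Finset.sum_comm]
          refine Finset.sum_congr rfl fun σ hσ => ?_
          rw [Finset.sum_mul]
          refine Finset.sum_congr rfl fun i _ => ?_
          simp only [a, (lift_spec hσ).2]
      _ = ∑ σ ∈ S, (if σ = 1 then (1 : CompletedAlgClosure F) else 0) * (lift σ • x) := by
          refine Finset.sum_congr rfl fun σ _ => ?_
          congr 1
          have h := congrArg (fun y : N => ((y : NormedAlgClosure F) : CompletedAlgClosure F))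
            (sum_mul_aut_traceDual_eq b σ)
          rw [coe_coe_sum hp N] at h
          simp_rw [IntermediateField.coe_mul, Completion.coe_mul] at h
          rw [h]
          split_ifs <;> simp
      _ = lift 1 • x := by
          simp_rw [ite_mul, one_mul, zero_mul]
          rw [Finset.sum_ite_eq' S (1 : Q) (fun σ => lift σ • x), if_pos one_mem_S]
      _ = x := by
          refine hx _ (lift_spec one_mem_S).1 ((restrictNormalHom_eq_one_iff hp N _).mp ?_)
          exact (lift_spec one_mem_S).2

omit [FiniteDimensional (PadicBase F p hp) N] [IsGalois (PadicBase F p hp) N] in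
/-- Expansion of `↑↑y` (`y ∈ N`) along a `K₀`-basis `b` of `N` inside `ℂ_F`:
`↑↑y = ∑ m, ι(b.repr y m) · ↑↑(b m)`. [folklore] -/
private theorem coe_coe_eq_sum_repr {κ' : Type} [Fintype κ'] (b : Basis κ' (PadicBase F p hp) N) (y : N) :
    (((y : N) : NormedAlgClosure F) : CompletedAlgClosure F) =
      ∑ m, ι hp (b.repr y m) * (((b m : N) : NormedAlgClosure F) : CompletedAlgClosure F) := by
  conv_lhs => rw [← b.sum_repr y]
  rw [coe_coe_sum hp N]
  refine Finset.sum_congr rfl fun m _ => ?_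
  rw [IntermediateField.coe_smul, coe_base_smul]

/-- ★ **`H_N`-fixed, `Gal(F̄/N)`-finite elements of `ℂ_F` are algebraic** (scalar case of Sen's
theorem over the `p`-adic field `N`, reduced to the base tower).  Let `N ⊆ F̄` be finite Galois over
`K₀` and `x ∈ ℂ_F` be fixed by `H_N = H ∩ Gal(F̄/N)` and such that its orbit under `Gal(F̄/N)` (the
`g ∈ G₀` fixing `N` pointwise) lies in the `K₀`-span of finitely many elements of `ℂ_F`.  Then
`x ∈ F̄`, indeed `x ∈ N K_∞`: by the descent formula `x = ∑ b_i c_i` with `c_i ∈ \widehat{K_∞}` of the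
shape `∑_t a_{i,t} (t • x)`; for `g ∈ Gal(F̄/N)`, `g • c_i = ∑_t a_{i,t} · t • ((t⁻¹ g t) • x)` with
`t⁻¹ g t ∈ Gal(F̄/N)` (normality), so the `Gal(F̄/N)`-orbit of `c_i` lies in the `K₀`-span of the
products `b_m · (t • b'_j)`; `Gal(F̄/N)` has finite index in `G₀` (transversal: lifts of `Gal(N/K₀)`),
so `c_i ∈ K_∞` by `exists_mem_image_K_of_subgroup_orbit_subset_span`, and `x = ∑ b_i c_i ∈ N K_∞`.
[cite: BrinonConrad2009, Thm. 15.1.2 and Thm. 15.1.5 (case of the trivial representation)] -/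
theorem exists_coe_eq_of_forall_smul_eq_of_orbit_subset_span {x : CompletedAlgClosure F}
    (hx : ∀ g : BaseGaloisGroup hp, (∀ M, g • zeta F p M = zeta F p M) →
      (∀ y : N, g • (y : NormedAlgClosure F) = y) → g • x = x)
    {κ : Type} [Fintype κ] (b' : κ → CompletedAlgClosure F)
    (horb : ∀ g : BaseGaloisGroup hp, (∀ y : N, g • (y : NormedAlgClosure F) = y) →
      ∃ c : κ → PadicBase F p hp, g • x = ∑ j, ι hp (c j) * b' j) :
    ∃ y ∈ N ⊔ Kinf hp, (y : CompletedAlgClosure F) = x := by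
  classical
  let Q := N ≃ₐ[PadicBase F p hp] N
  let r : BaseGaloisGroup hp →* Q := AlgEquiv.restrictNormalHom N
  let b := Module.finBasis (PadicBase F p hp) N
  obtain ⟨T, a, hT, hX, hxeq⟩ := exists_sum_coe_mul_eq_of_forall_smul_eq hp N b hx
  -- the subgroup `G' = Gal(F̄/N)` and a transversal
  let G' : Subgroup (BaseGaloisGroup hp) := N.fixingSubgroup
  have hG' : ∀ {g : BaseGaloisGroup hp}, g ∈ G' ↔ ∀ y : N, g • (y : NormedAlgClosure F) = y := by
    intro g
    rw [IntermediateField.mem_fixingSubgroup_iff]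
    exact ⟨fun h y => h y y.2, fun h y hy => h ⟨y, hy⟩⟩
  have hG'r : ∀ {g : BaseGaloisGroup hp}, g ∈ G' ↔ r g = 1 := fun {g} => hG'.trans (restrictNormalHom_eq_one_iff hp N g).symm
  have hconj : ∀ {g : BaseGaloisGroup hp} (t : BaseGaloisGroup hp), g ∈ G' → t⁻¹ * g * t ∈ G' := by
    intro g t hg
    rw [hG'r] at hg ⊢
    rw [map_mul, map_mul, hg, mul_one, map_inv, inv_mul_cancel]
  have hsurj : Function.Surjective r := AlgEquiv.restrictNormalHom_surjective (NormedAlgClosure F)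
  let R : Finset (BaseGaloisGroup hp) := Finset.univ.image (Function.surjInv hsurj)
  have hR : ∀ g : BaseGaloisGroup hp, ∃ t ∈ R, ∃ h ∈ G', g = t * h := by
    intro g
    refine ⟨Function.surjInv hsurj (r g), Finset.mem_image_of_mem _ (Finset.mem_univ _),
      (Function.surjInv hsurj (r g))⁻¹ * g, ?_, (mul_inv_cancel_left _ _).symm⟩
    rw [hG'r, map_mul, map_inv, Function.surjInv_eq hsurj, inv_mul_cancel]
  -- each coordinate `c_i` lies in `K_∞`
  have hc : ∀ i, (∑ t ∈ T, (((a i t : N) : NormedAlgClosure F) : CompletedAlgClosure F) * (t • x)) ∈ S hp := by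
    intro i
    -- the orbit of `(g t) • x`, `g ∈ G'`, `t ∈ T`
    have step : ∀ g ∈ G', ∀ t : BaseGaloisGroup hp, ∃ c : κ → PadicBase F p hp,
        (g * t) • x = ∑ j, ι hp (c j) * (t • b' j) := by
      intro g hg t
      obtain ⟨c, hc⟩ := horb (t⁻¹ * g * t) (hG'.mp (hconj t hg))
      refine ⟨c, ?_⟩
      have e : g * t = t * (t⁻¹ * g * t) := by group
      rw [e, mul_smul, hc, Finset.smul_sum]
      simp_rw [smul_mul', base_smul_ι]
    let fam : (T × (Fin (Module.finrank (PadicBase F p hp) N) × κ)) → CompletedAlgClosure F :=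
      fun tmj => (((b tmj.2.1 : N) : NormedAlgClosure F) : CompletedAlgClosure F) *
        (((tmj.1 : T) : BaseGaloisGroup hp) • b' tmj.2.2)
    suffices horb' : ∀ g ∈ G', ∃ c' : (T × (Fin (Module.finrank (PadicBase F p hp) N) × κ)) → PadicBase F p hp,
        g • (∑ t ∈ T, (((a i t : N) : NormedAlgClosure F) : CompletedAlgClosure F) * (t • x)) =
          ∑ tmj, ι hp (c' tmj) * fam tmj by
      obtain ⟨n, -, -, y, hy, hyeq⟩ :=
        exists_mem_image_K_of_subgroup_orbit_subset_span hp (hX i) G' R hR fam horb'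
      exact (mem_S_iff hp).mpr ⟨y, K_le_Kinf hp n hy, hyeq⟩
    -- the orbit computation
    intro g hg
    choose! c hcg using step g hg
    refine ⟨fun tmj => b.repr (a i tmj.1) tmj.2.1 * c tmj.1 tmj.2.2, ?_⟩
    have hga : ∀ t, r g (a i t) = a i t := by
      intro t
      rw [hG'r.mp hg, AlgEquiv.one_apply]
    have lhs : g • (∑ t ∈ T, (((a i t : N) : NormedAlgClosure F) : CompletedAlgClosure F) * (t • x)) =
        ∑ t ∈ T, (((a i t : N) : NormedAlgClosure F) : CompletedAlgClosure F) *
          ∑ j, ι hp (c t j) * (t • b' j) := by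
      rw [Finset.smul_sum]
      refine Finset.sum_congr rfl fun t _ => ?_
      rw [smul_mul', base_smul_coe_coe hp N, hga, ← mul_smul, hcg t]
    rw [lhs]
    -- both sides as iterated sums
    rw [← Finset.sum_coe_sort T, Fintype.sum_prod_type]
    refine Finset.sum_congr rfl fun t _ => ?_
    rw [Fintype.sum_prod_type, coe_coe_eq_sum_repr hp N b (a i t), Finset.sum_mul]
    refine Finset.sum_congr rfl fun m _ => ?_
    rw [Finset.mul_sum]
    refine Finset.sum_congr rfl fun j _ => ?_
    simp only [fam]
    rw [← ιHom_apply, ← ιHom_apply, ← ιHom_apply, map_mul]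
    ring
  -- assemble `x = ∑ b_i c_i ∈ N K_∞`
  choose y hyK hyeq using fun i => (mem_S_iff hp).mp (hc i)
  refine ⟨∑ i, (b i : NormedAlgClosure F) * y i, ?_, ?_⟩
  · refine IntermediateField.sum_mem _ fun i _ => IntermediateField.mul_mem _ ?_ ?_
    · exact (le_sup_left : N ≤ N ⊔ Kinf hp) (b i).2
    · exact (le_sup_right : Kinf hp ≤ N ⊔ Kinf hp) (hyK i)
  · rw [hxeq]
    change Completion.coeRingHom (∑ i, (b i : NormedAlgClosure F) * y i) = _
    rw [map_sum]
    refine Finset.sum_congr rfl fun i _ => ?_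
    change (((b i : NormedAlgClosure F) * y i : NormedAlgClosure F) : CompletedAlgClosure F) = _
    rw [Completion.coe_mul, hyeq]

/-- ★ **Sen's theorem, scalar case, over the `p`-adic field `F`: `(\widehat{F_∞})^{Γ_F-fin} ⊆ F̄`.**
An element `x ∈ ℂ_F` fixed by `H_F = Γ_F ∩ H` (the `σ ∈ Γ_F` fixing every `ζ_{p^M}`, i.e. the kernel
of the cyclotomic character) whose `Γ_F`-orbit lies in the `K₀`-span of finitely many elements of
`ℂ_F` is algebraic: `x ∈ F̄` (indeed in `N K_∞` for the normal closure `N` of `F/K₀`) — the previous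
theorem for `N = ` the normal closure of `F` in `F̄` over `K₀` (finite Galois; `Gal(F̄/N) ≤ Γ_F` via
`BaseGaloisGroup.exists_toBase_eq`). [cite: BrinonConrad2009, Thm. 15.1.2 and Thm. 15.1.5 (case of the trivial representation)] -/
theorem exists_coe_eq_of_forall_absoluteGaloisGroup_smul_eq_of_orbit_subset_span
    {x : CompletedAlgClosure F}
    (hx : ∀ σ : absoluteGaloisGroup F,
      (∀ M, BaseGaloisGroup.toBase hp σ • zeta F p M = zeta F p M) → σ • x = x)
    {κ : Type} [Fintype κ] (b' : κ → CompletedAlgClosure F)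
    (horb : ∀ σ : absoluteGaloisGroup F, ∃ c : κ → PadicBase F p hp,
      σ • x = ∑ j, ι hp (c j) * b' j) :
    ∃ y : NormedAlgClosure F, (y : CompletedAlgClosure F) = x := by
  let N : IntermediateField (PadicBase F p hp) (NormedAlgClosure F) :=
    IntermediateField.normalClosure (PadicBase F p hp) F (NormedAlgClosure F)
  haveI : FiniteDimensional (PadicBase F p hp) N :=
    normalClosure.is_finiteDimensional (PadicBase F p hp) F (NormedAlgClosure F)
  haveI : IsGalois (PadicBase F p hp) N := IsGalois.normalClosure (PadicBase F p hp) F (NormedAlgClosure F)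
  have hFN : ∀ c : F, algebraMap F (NormedAlgClosure F) c ∈ N := fun c =>
    (IsScalarTower.toAlgHom (PadicBase F p hp) F (NormedAlgClosure F)).fieldRange_le_normalClosure
      ⟨c, rfl⟩
  -- an automorphism fixing `N` pointwise fixes `F`, hence comes from `Γ_F`
  have hΓ : ∀ g : BaseGaloisGroup hp, (∀ y : N, g • (y : NormedAlgClosure F) = y) →
      ∃ σ : absoluteGaloisGroup F, BaseGaloisGroup.toBase hp σ = g := fun g hg =>
    BaseGaloisGroup.exists_toBase_eq hp g fun c => hg ⟨_, hFN c⟩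
  obtain ⟨y, -, hy⟩ := exists_coe_eq_of_forall_smul_eq_of_orbit_subset_span hp N (x := x)
    (fun g hgz hgN => by
      obtain ⟨σ, rfl⟩ := hΓ g hgN
      rw [CompletedAlgClosure.toBase_smul_completion hp]
      exact hx σ hgz)
    b' (fun g hgN => by
      obtain ⟨σ, rfl⟩ := hΓ g hgN
      rw [CompletedAlgClosure.toBase_smul_completion hp]
      exact horb σ)
  exact ⟨y, hy⟩

end TateTrace

end Literature.NumberTheory.PAdicHodge
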